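import Literature.Analysis.DeBrangesSpaces.DeBranges1986CharacterSpaces
import Literature.NumberTheory.LFunctions.DirichletLZeroCounting
import Literature.NumberTheory.LFunctions.DirichletLFunctionInverseBound
import Literature.NumberTheory.LFunctions.DirichletLFunctionBounds
import Literature.Analysis.SpecialFunctions.GammaStirlingUniform
import Mathlib.Analysis.Complex.PhragmenLindelof
import HarnessLib

/-!
# de Branges 1986, p. 12: the structure functions `E_χ(a, z)` are Hermite–Biehler (PROVED)

LABEL (line 1): **RH-FREE** — discharge of the named fact
`Literature.Analysis.DeBrangesSpaces.DeBranges1986.deBranges1986_isHermiteBiehler_EChar`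
(`DeBranges1986CharacterSpaces.lean`): for a primitive even character `χ` modulo `r ≠ 1` and
`a ≥ 1`, de Branges' `E_χ(a, z) = a^{−iz/2} (r/π)^{(1−iz)/2} Γ((1−iz)/2) ζ_χ(1−iz)` satisfies
`|E_χ(a, x − iy)| < |E_χ(a, x + iy)|` for `y > 0` (L. de Branges, *The Riemann hypothesis for
Hilbert spaces of entire functions*, Bull. AMS 15 (1986), p. 12 l. 22–29: "Since `W_χ(z)` is not a
constant of absolute value one, the strict inequality `|W_χ(z)| < 1` holds in the upper half-plane …
Since `|E_χ(a, x − iy)| < |E_χ(a, x + iy)|` when `y > 0`, a space `𝓗(E_χ(a))` exists").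
This is an unconditional structure-function property (the Dirichlet analogue of Lagarias 2005,
Lemma 2.1 (1) at `h = ½`, tree `Literature.NumberTheory.LFunctions.lagarias2005_lemma_2_1`); it is
NOT a positivity condition (Conrey–Li GUARD R7, unconditional branch). bears_on: LADDER-RH COLUMN 6
(DBR), B-C/B-P. WHAT THIS IS NOT: not progress toward RH; nothing here bears on the truth of RH.

## The argument (Phragmén–Lindelöf in place of de Branges' scattering bound / the Hadamard product)

Everything reduces to the **shift inequality** `|ξ(z, χ)| < |ξ(z + 1, χ)|` for `Re z > 0`
(`norm_dirichletXi_lt_norm_dirichletXi_add_one`; `ξ(s, χ)` = Montgomery–Vaughan's completed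
`L`-function, tree `dirichletXi`): with `w = −iz`, `E_χ(1, z) = ξ(w + 1, χ)` and
`|E_χ(1, z̄)| = |ξ(1 − w̄, χ)| = |ξ(w, χ)|` by `ξ(1 − s̄, χ) = ε(χ) conj ξ(s, χ)`
(`Literature.NumberTheory.LFunctions.DirichletTheta.dirichletXi_one_sub_conj`, `|ε(χ)| = 1`), and the
factor `a^{−iz/2}` has modulus `a^{y/2} ≥ a^{−y/2}` for `a ≥ 1`.

de Branges obtains `|W_χ| ≤ 1` (`W_χ = ε(χ)E♯/E`) from the isometries of his Theorems 1–3
("an estimate of Mellin transforms", Theorem 4) and strictness from `W_χ` not being a unimodular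
constant; Lagarias (2005/2006) argues zero by zero in the genus-one Hadamard product of `ξ(s, χ)`.
Neither tool is in the tree for Dirichlet `L`-functions, so the shift inequality is proved here by the
Phragmén–Lindelöf principle on the right half-plane (Mathlib
`PhragmenLindelof.right_half_plane_of_tendsto_zero_on_real`) applied to
`g(z) = ξ(z, χ)/ξ(z + 1, χ)`, holomorphic on `Re z ≥ 0` since `ξ(s, χ) ≠ 0` for `Re s ≥ 1`
(`dirichletXi_ne_zero_of_not_mem_strip`):

* `|g| = 1` on `Re z = 0` (the reflection formula again);
* `g(x) → 0` as `x → +∞` along the reals (`tendsto_dirichletXi_div_atTop`: `|L(x, χ)| ≤ 2`,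
  `|L(x+1, χ)| ≥ ½`, and `Γ(u)/Γ(u + ½) ≤ e (u + ½)^{−1/2}` from Stirling);
* `|g(z)| ≤ exp(B|z|^{3/2})` on the half-plane (`exists_norm_dirichletXi_le_exp'`,
  `exists_exp_neg_le_norm_dirichletXi`): the uniform Stirling formula of the tree
  (`Literature.Analysis.SpecialFunctions.GammaStirling.abs_log_norm_Gamma_sub_le`, giving
  `|log|Γ(w)|| ≤ 13|w|^{3/2}`), the crude bound `|L(s, χ)| ≤ q|s|Z` for `σ ≥ ¼`
  (`DirichletZFR.norm_LFunction_le_of_re_ge`, MV Lemma 10.15; for `0 < σ < ½` one reflects first),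
  `|L(s, χ)| ≥ (σ−1)/σ` (`DirichletZFR.norm_LFunction_ge`) and, on `σ ≥ 1`, `|t| ≥ 1`, the
  Montgomery–Vaughan Theorem 11.4 bound `1/|L(s, χ)| ≪ log q(|t|+4)`
  (`DirichletZFR.exists_inv_LFunction_bounds`).

Hence `|g| ≤ 1` on `Re z ≥ 0`, and `|g(z₀)| = 1` at an interior point would make `g` a unimodular
constant (maximum modulus principle, `Complex.eqOn_of_isPreconnected_of_isMaxOn_norm`),
contradicting `g(x) → 0`.

## Main results (namespace `Literature.Analysis.DeBrangesSpaces.DeBranges1986`)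

* `deBranges1986_isHermiteBiehler_EChar_holds` — the discharge.
* `isHermiteBiehler_EChar` — `E_χ(a, ·)` is Hermite–Biehler for every primitive `χ` mod `r ≠ 1`
  (either parity) and `a ≥ 1`.
* `norm_dirichletXi_lt_norm_dirichletXi_add_one` — `|ξ(z, χ)| < |ξ(z + 1, χ)|`, `Re z > 0`.
* `norm_rootNumber_mul_dirichletXi_inv_lt`, `deBranges1986_thm4_i` — the first conjunct of the named
  fact `deBranges1986_thm4` (`|ε(χ) ξ(1+iz, χ̄)| ≤ |ξ(1−iz, χ)|`, i.e. `|W_χ| ≤ 1`), proved, even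
  strictly. (The Mellin-transform conjunct of Theorem 4 is not discharged here.)
* Tools: `abs_log_norm_Gamma_le` (`|log|Γ(w)|| ≤ 13|w|^{3/2}` on `Re w > 0`, `|w| ≥ 1`),
  `real_Gamma_le_mul_Gamma_add_half`, `norm_dirichletXi_eq`, `exists_norm_inv_LFunction_le`.

## References

* [deBranges1986] L. de Branges, Bull. AMS (N.S.) 15 (1986) 1–17, p. 12 l. 22–29 and Theorem 4
  (pp. 11–12) (held copy `paper:url-012807b01c95`, page images read by the typer of the statement file).
* [Lagarias2005] J. C. Lagarias, Acta Arith. 120 (2005), Lemma 2.1 (the `ζ` case, Hadamard product).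
* [MontgomeryVaughan2007] H. L. Montgomery, R. C. Vaughan, *Multiplicative Number Theory I*, CUP 2007,
  (10.19), Cor. 10.8, Lemma 10.15, Theorem 11.4.
-/

noncomputable section

open scoped ComplexConjugate Real Topology
open Complex Filter Set Asymptotics

namespace Literature.Analysis.DeBrangesSpaces
namespace DeBranges1986

open Literature.NumberTheory.LFunctions (charParity charParity_of_even charParity_of_odd)
open Literature.NumberTheory.LFunctions.DirichletTheta
open Literature.NumberTheory.LFunctions.DirichletZFR (norm_LFunction_le_of_re_ge norm_LFunction_ge
  exists_inv_LFunction_bounds one_le_tsum_rpow ell_pos)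
open Literature.Analysis.SpecialFunctions.GammaStirling (abs_log_norm_Gamma_sub_le)
open Literature.NumberTheory.LFunctions.ZetaClassicalRegion (norm_LSeries_le_of_norm_le_one)

/-! ## Stirling-size bounds for `Γ` on the right half-plane -/

/-- The uniform Stirling remainder is at most `1/4` once `‖w‖ ≥ 1` (`Re w > 0`):
`|log ‖Γ(w)‖ − ((Re w − ½) log ‖w‖ − Im w · Arg w − Re w + ½ log 2π)| ≤ 1/4`. [folklore] -/
private theorem abs_log_norm_Gamma_sub_le_quarter {w : ℂ} (hw : 0 < w.re) (hw1 : 1 ≤ ‖w‖) :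
    |Real.log ‖Complex.Gamma w‖ -
        ((w.re - 1 / 2) * Real.log ‖w‖ - w.im * Complex.arg w - w.re + Real.log (2 * π) / 2)| ≤
      1 / 4 := by
  refine (abs_log_norm_Gamma_sub_le hw).trans ?_
  have h0 : 0 < ‖w‖ := by linarith
  have h1 : 1 / ‖w‖ ^ 2 ≤ 1 := by
    rw [div_le_one (by positivity)]
    nlinarith
  have h2 : π / (2 * ‖w‖) ≤ 2 := by
    rw [div_le_iff₀ (by positivity)]
    linarith [Real.pi_le_four]
  nlinarith

/-- **`|log ‖Γ(w)‖| ≤ 13 ‖w‖^{3/2}`** for `Re w > 0`, `‖w‖ ≥ 1` (first-order Stirling, crude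
constants: `|(Re w − ½) log‖w‖| ≤ 3‖w‖^{3/2}` via `log x ≤ 2√x`, `|Im w · Arg w| ≤ 4‖w‖`,
`½ log 2π ≤ 4`); a corollary of Stirling's formula for `log Γ` in the half-plane `Re w > 0`
(Titchmarsh, *Theory of Functions*, §4.42, via the tree's uniform form
`GammaStirling.abs_log_norm_Gamma_sub_le`). [cite: Titchmarsh1939, §4.42] -/
theorem abs_log_norm_Gamma_le {w : ℂ} (hw : 0 < w.re) (hw1 : 1 ≤ ‖w‖) :
    |Real.log ‖Complex.Gamma w‖| ≤ 13 * ‖w‖ ^ (3 / 2 : ℝ) := by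
  have hq := abs_log_norm_Gamma_sub_le_quarter hw hw1
  set M : ℝ := (w.re - 1 / 2) * Real.log ‖w‖ - w.im * Complex.arg w - w.re + Real.log (2 * π) / 2
    with hM
  have h0 : 0 < ‖w‖ := by linarith
  have h32 : ‖w‖ ≤ ‖w‖ ^ (3 / 2 : ℝ) := by
    have := Real.rpow_le_rpow_of_exponent_le hw1 (show (1 : ℝ) ≤ 3 / 2 by norm_num)
    rwa [Real.rpow_one] at this
  have h032 : 1 ≤ ‖w‖ ^ (3 / 2 : ℝ) := Real.one_le_rpow hw1 (by norm_num)
  have hlog0 : 0 ≤ Real.log ‖w‖ := Real.log_nonneg hw1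
  have hlog : Real.log ‖w‖ ≤ 2 * ‖w‖ ^ (1 / 2 : ℝ) := by
    have h := Real.log_le_rpow_div (norm_nonneg w) (show (0 : ℝ) < 1 / 2 by norm_num)
    rw [div_eq_mul_inv, show ((1 : ℝ) / 2)⁻¹ = 2 by norm_num] at h
    linarith
  have hmul : ‖w‖ * ‖w‖ ^ (1 / 2 : ℝ) = ‖w‖ ^ (3 / 2 : ℝ) := by
    rw [show (3 / 2 : ℝ) = 1 + 1 / 2 by norm_num, Real.rpow_add h0, Real.rpow_one]
  have t1 : |(w.re - 1 / 2) * Real.log ‖w‖| ≤ 3 * ‖w‖ ^ (3 / 2 : ℝ) := by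
    rw [abs_mul, abs_of_nonneg hlog0]
    have hre : |w.re - 1 / 2| ≤ 3 / 2 * ‖w‖ := by
      have h1 : |w.re - 1 / 2| ≤ |w.re| + |(1 / 2 : ℝ)| := abs_sub _ _
      have h2 : |w.re| ≤ ‖w‖ := Complex.abs_re_le_norm w
      rw [abs_of_pos (by norm_num : (0 : ℝ) < 1 / 2)] at h1
      linarith
    calc |w.re - 1 / 2| * Real.log ‖w‖ ≤ (3 / 2 * ‖w‖) * (2 * ‖w‖ ^ (1 / 2 : ℝ)) :=
          mul_le_mul hre hlog hlog0 (by positivity)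
      _ = 3 * ‖w‖ ^ (3 / 2 : ℝ) := by rw [← hmul]; ring
  have t2 : |w.im * Complex.arg w| ≤ 4 * ‖w‖ := by
    rw [abs_mul]
    calc |w.im| * |Complex.arg w| ≤ ‖w‖ * π :=
          mul_le_mul (Complex.abs_im_le_norm w) (Complex.abs_arg_le_pi w) (abs_nonneg _)
            (norm_nonneg _)
      _ ≤ ‖w‖ * 4 := by gcongr; exact Real.pi_le_four
      _ = 4 * ‖w‖ := by ring
  have t3 : |w.re| ≤ ‖w‖ := Complex.abs_re_le_norm w
  have t4 : |Real.log (2 * π) / 2| ≤ 4 := by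
    have hp : 0 < 2 * π := by positivity
    have h5 : Real.log (2 * π) ≤ 2 * π - 1 := Real.log_le_sub_one_of_pos hp
    have h6 : 0 ≤ Real.log (2 * π) := Real.log_nonneg (by linarith [Real.pi_gt_three])
    rw [abs_le]; constructor <;> linarith [Real.pi_le_four]
  have hMle : |M| ≤ 12 * ‖w‖ ^ (3 / 2 : ℝ) := by
    obtain ⟨a1, a2⟩ := abs_le.1 t1
    obtain ⟨b1, b2⟩ := abs_le.1 t2
    obtain ⟨c1, c2⟩ := abs_le.1 t3
    obtain ⟨d1, d2⟩ := abs_le.1 t4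
    rw [abs_le]
    constructor <;> linarith
  calc |Real.log ‖Complex.Gamma w‖| = |(Real.log ‖Complex.Gamma w‖ - M) + M| := by ring_nf
    _ ≤ |Real.log ‖Complex.Gamma w‖ - M| + |M| := abs_add_le _ _
    _ ≤ 1 / 4 + 12 * ‖w‖ ^ (3 / 2 : ℝ) := add_le_add hq hMle
    _ ≤ 13 * ‖w‖ ^ (3 / 2 : ℝ) := by linarith

/-- `‖Γ(w)‖ ≤ exp(13 ‖w‖^{3/2})` for `Re w > 0`, `‖w‖ ≥ 1`. [folklore] -/
private theorem norm_Gamma_le_exp {w : ℂ} (hw : 0 < w.re) (hw1 : 1 ≤ ‖w‖) :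
    ‖Complex.Gamma w‖ ≤ Real.exp (13 * ‖w‖ ^ (3 / 2 : ℝ)) := by
  have hpos : 0 < ‖Complex.Gamma w‖ := norm_pos_iff.2 (Complex.Gamma_ne_zero_of_re_pos hw)
  have h := (abs_le.1 (abs_log_norm_Gamma_le hw hw1)).2
  calc ‖Complex.Gamma w‖ = Real.exp (Real.log ‖Complex.Gamma w‖) := (Real.exp_log hpos).symm
    _ ≤ Real.exp (13 * ‖w‖ ^ (3 / 2 : ℝ)) := Real.exp_le_exp.2 h

/-- `exp(−13 ‖w‖^{3/2}) ≤ ‖Γ(w)‖` for `Re w > 0`, `‖w‖ ≥ 1`. [folklore] -/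
private theorem exp_neg_le_norm_Gamma {w : ℂ} (hw : 0 < w.re) (hw1 : 1 ≤ ‖w‖) :
    Real.exp (-(13 * ‖w‖ ^ (3 / 2 : ℝ))) ≤ ‖Complex.Gamma w‖ := by
  have hpos : 0 < ‖Complex.Gamma w‖ := norm_pos_iff.2 (Complex.Gamma_ne_zero_of_re_pos hw)
  have h := (abs_le.1 (abs_log_norm_Gamma_le hw hw1)).1
  calc Real.exp (-(13 * ‖w‖ ^ (3 / 2 : ℝ))) ≤ Real.exp (Real.log ‖Complex.Gamma w‖) :=
        Real.exp_le_exp.2 h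
    _ = ‖Complex.Gamma w‖ := Real.exp_log hpos

/-- Real Stirling ratio: `Γ(u) ≤ e · (u + ½)^{−1/2} · Γ(u + ½)` for real `u ≥ 1`. [folklore] -/
private theorem real_Gamma_le_mul_Gamma_add_half {u : ℝ} (hu : 1 ≤ u) :
    Real.Gamma u ≤ Real.exp 1 * (u + 1 / 2) ^ (-(1 / 2 : ℝ)) * Real.Gamma (u + 1 / 2) := by
  have hu0 : 0 < u := by linarith
  have hv0 : 0 < u + 1 / 2 := by linarith
  -- Stirling for `u` and `u + 1/2` as complex numbers on the positive real axis
  have hn1 : ‖(u : ℂ)‖ = u := by rw [Complex.norm_real, Real.norm_eq_abs, abs_of_pos hu0]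
  have hn2 : ‖((u + 1 / 2 : ℝ) : ℂ)‖ = u + 1 / 2 := by
    rw [Complex.norm_real, Real.norm_eq_abs, abs_of_pos hv0]
  have h1 := abs_log_norm_Gamma_sub_le_quarter (w := (u : ℂ)) (by simpa using hu0)
    (by rw [hn1]; exact hu)
  have h2 := abs_log_norm_Gamma_sub_le_quarter (w := ((u + 1 / 2 : ℝ) : ℂ)) (by rw [Complex.ofReal_re]; linarith)
    (by rw [hn2]; linarith)
  rw [hn1, Complex.ofReal_re, Complex.ofReal_im, Complex.arg_ofReal_of_nonneg hu0.le,
    Complex.Gamma_ofReal, Complex.norm_real, Real.norm_eq_abs,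
    abs_of_pos (Real.Gamma_pos_of_pos hu0)] at h1
  rw [hn2, Complex.ofReal_re, Complex.ofReal_im, Complex.arg_ofReal_of_nonneg hv0.le,
    Complex.Gamma_ofReal, Complex.norm_real, Real.norm_eq_abs,
    abs_of_pos (Real.Gamma_pos_of_pos hv0)] at h2
  have hlog : Real.log u ≤ Real.log (u + 1 / 2) := Real.log_le_log hu0 (by linarith)
  have hG1 : 0 < Real.Gamma u := Real.Gamma_pos_of_pos hu0
  have hG2 : 0 < Real.Gamma (u + 1 / 2) := Real.Gamma_pos_of_pos hv0
  -- `log Γ(u) − log Γ(u+½) ≤ 1 − ½ log(u+½)`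
  have key : Real.log (Real.Gamma u) ≤
      1 + (-(1 / 2 : ℝ)) * Real.log (u + 1 / 2) + Real.log (Real.Gamma (u + 1 / 2)) := by
    obtain ⟨a1, a2⟩ := abs_le.1 h1
    obtain ⟨b1, b2⟩ := abs_le.1 h2
    simp only [zero_mul, sub_zero] at a2 b1
    nlinarith [mul_le_mul_of_nonneg_left hlog (by linarith : (0 : ℝ) ≤ u - 1 / 2)]
  calc Real.Gamma u = Real.exp (Real.log (Real.Gamma u)) := (Real.exp_log hG1).symm
    _ ≤ Real.exp (1 + (-(1 / 2 : ℝ)) * Real.log (u + 1 / 2) + Real.log (Real.Gamma (u + 1 / 2))) :=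
        Real.exp_le_exp.2 key
    _ = Real.exp 1 * (u + 1 / 2) ^ (-(1 / 2 : ℝ)) * Real.Gamma (u + 1 / 2) := by
        rw [Real.exp_add, Real.exp_add, Real.exp_log hG2, Real.rpow_def_of_pos hv0, mul_comm (Real.log _)]

/-! ## The completed Dirichlet `L`-function: size on the right half-plane -/

variable {q : ℕ} [NeZero q] {χ : DirichletCharacter ℂ q}

/-- A primitive character to a modulus `q ≠ 1` is non-principal. [folklore] -/
private theorem ne_one_of_isPrimitive' (hχ : χ.IsPrimitive) (hq : q ≠ 1) : χ ≠ 1 := by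
  rintro rfl
  rw [DirichletCharacter.isPrimitive_def, DirichletCharacter.conductor_one] at hχ
  exact hq hχ.symm

/-- The parity exponent `κ ∈ {0, 1}`. [folklore] -/
private theorem charParity_le_one (χ : DirichletCharacter ℂ q) : charParity χ ≤ 1 := by
  rcases χ.even_or_odd with h | h
  · rw [charParity_of_even h]; exact zero_le_one
  · rw [charParity_of_odd h]

/-- `‖ε(χ)‖ = 1` for primitive `χ`. [cite: MontgomeryVaughan2007, §10.1 p. 333] -/
private theorem norm_rootNumber' (hχ : χ.IsPrimitive) : ‖χ.rootNumber‖ = 1 :=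
  Literature.NumberTheory.LFunctions.SelbergDirichlet.norm_rootNumber hχ

/-- **`|ξ(s, χ)| = |L(s, χ)| · |Γ((s+κ)/2)| · (q/π)^{(σ+κ)/2}`** for `σ = Re s > 0` (MV (10.19), off the
trivial zeros). [cite: MontgomeryVaughan2007, (10.19)] -/
theorem norm_dirichletXi_eq (h1 : χ ≠ 1) {s : ℂ} (hs : 0 < s.re) :
    ‖dirichletXi χ s‖ = ‖χ.LFunction s‖ * ‖Complex.Gamma ((s + charParity χ) / 2)‖ *
      ((q : ℝ) / π) ^ ((s.re + charParity χ) / 2) := by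
  have hs' : ∀ n : ℕ, s + charParity χ ≠ -(2 * (n : ℂ)) := by
    intro n h
    have := congrArg Complex.re h
    simp only [Complex.add_re, Complex.natCast_re, Complex.neg_re, Complex.mul_re, Complex.re_ofNat,
      Complex.im_ofNat, Complex.natCast_im, mul_zero, sub_zero] at this
    linarith [(charParity χ).cast_nonneg (α := ℝ), (n.cast_nonneg (α := ℝ))]
  rw [dirichletXi_eq_LFunction_mul h1 hs', norm_mul, norm_mul]
  congr 1
  have hb : ((q : ℂ) / π) = (((q : ℝ) / π : ℝ) : ℂ) := by push_cast; rfl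
  rw [hb, Complex.norm_cpow_eq_rpow_re_of_pos (div_pos (Nat.cast_pos.2 (NeZero.pos q)) Real.pi_pos)]
  congr 1
  simp only [Complex.div_ofNat_re, Complex.add_re, Complex.natCast_re]

/-- `‖(s + κ)/2‖ ≥ ‖s‖/2` and `≤ ‖s‖` when `Re s ≥ 0`, `‖s‖ ≥ 1`. [folklore] -/
private theorem norm_half_add_parity_bounds {s : ℂ} (hs : 0 ≤ s.re) (h1 : 1 ≤ ‖s‖) :
    ‖s‖ / 2 ≤ ‖(s + charParity χ) / 2‖ ∧ ‖(s + charParity χ) / 2‖ ≤ ‖s‖ := by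
  have hκ : (charParity χ : ℝ) ≤ 1 := by exact_mod_cast charParity_le_one χ
  have hκ0 : (0 : ℝ) ≤ charParity χ := (charParity χ).cast_nonneg
  constructor
  · rw [norm_div, Complex.norm_ofNat]
    gcongr
    -- `‖s‖ ≤ ‖s + κ‖` since `Re s, κ ≥ 0`
    rw [← Real.sqrt_sq (norm_nonneg s), ← Real.sqrt_sq (norm_nonneg (s + _)),
      Complex.sq_norm, Complex.sq_norm, Complex.normSq_apply, Complex.normSq_apply]
    apply Real.sqrt_le_sqrt
    simp only [Complex.add_re, Complex.natCast_re, Complex.add_im, Complex.natCast_im, add_zero]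
    nlinarith
  · rw [norm_div, Complex.norm_ofNat]
    have : ‖s + (charParity χ : ℂ)‖ ≤ ‖s‖ + 1 := by
      refine (norm_add_le _ _).trans ?_
      rw [Complex.norm_natCast]
      linarith
    linarith

/-- **Upper bound** `|ξ(s, χ)| ≤ exp(K‖s‖^{3/2})` for `Re s ≥ ½`, `‖s‖ ≥ 2` (`K` depending on `q`
only): crude `|L(s, χ)| ≤ q‖s‖Z` (MV Lemma 10.15), Stirling for `Γ`, and `(q/π)^{Re} ≤ e^{q‖s‖}`.
[folklore] -/
private theorem exists_norm_dirichletXi_le_exp (h1 : χ ≠ 1) :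
    ∃ K : ℝ, 0 ≤ K ∧ ∀ s : ℂ, 1 / 2 ≤ s.re → 2 ≤ ‖s‖ →
      ‖dirichletXi χ s‖ ≤ Real.exp (K * ‖s‖ ^ (3 / 2 : ℝ)) := by
  set Z : ℝ := ∑' n : ℕ, ((n + 1 : ℕ) : ℝ) ^ (-(5 / 4 : ℝ)) with hZ
  have hZ1 : 1 ≤ Z := one_le_tsum_rpow
  refine ⟨q * Z + 13 + q, by positivity, fun s hs h2 ↦ ?_⟩
  have hs0 : 0 < s.re := by linarith
  have hx1 : 1 ≤ ‖s‖ := by linarith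
  have hx0 : 0 < ‖s‖ := by linarith
  set x : ℝ := ‖s‖ with hx
  have h32 : x ≤ x ^ (3 / 2 : ℝ) := by
    have := Real.rpow_le_rpow_of_exponent_le hx1 (show (1 : ℝ) ≤ 3 / 2 by norm_num)
    rwa [Real.rpow_one] at this
  have hx32 : 0 ≤ x ^ (3 / 2 : ℝ) := by positivity
  obtain ⟨hwlo, hwhi⟩ := norm_half_add_parity_bounds (χ := χ) hs0.le hx1
  set w : ℂ := (s + charParity χ) / 2 with hw
  have hwre : 0 < w.re := by
    rw [hw]
    simp only [Complex.div_ofNat_re, Complex.add_re, Complex.natCast_re]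
    linarith [(charParity χ).cast_nonneg (α := ℝ)]
  have hw1 : 1 ≤ ‖w‖ := by linarith
  -- the three factors
  have hL : ‖χ.LFunction s‖ ≤ Real.exp (q * Z * x ^ (3 / 2 : ℝ)) := by
    refine (norm_LFunction_le_of_re_ge χ h1 (by linarith)).trans ?_
    calc (q : ℝ) * ‖s‖ * Z = q * Z * x := by rw [hx]; ring
      _ ≤ q * Z * x ^ (3 / 2 : ℝ) := by gcongr
      _ ≤ Real.exp (q * Z * x ^ (3 / 2 : ℝ)) := by
          linarith [Real.add_one_le_exp (q * Z * x ^ (3 / 2 : ℝ))]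
  have hG : ‖Complex.Gamma w‖ ≤ Real.exp (13 * x ^ (3 / 2 : ℝ)) := by
    refine (norm_Gamma_le_exp hwre hw1).trans (Real.exp_le_exp.2 ?_)
    gcongr
  have hP : ((q : ℝ) / π) ^ ((s.re + charParity χ) / 2) ≤ Real.exp (q * x ^ (3 / 2 : ℝ)) := by
    have ha0 : 0 ≤ (s.re + charParity χ) / 2 := by
      linarith [(charParity χ).cast_nonneg (α := ℝ)]
    have ha1 : (s.re + charParity χ) / 2 ≤ x := by
      have hre : s.re ≤ ‖s‖ := Complex.re_le_norm s
      have hκ : (charParity χ : ℝ) ≤ 1 := by exact_mod_cast charParity_le_one χ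
      rw [hx]; linarith
    have hq1 : (1 : ℝ) ≤ q := by exact_mod_cast Nat.one_le_iff_ne_zero.2 (NeZero.ne q)
    have hqπ : (q : ℝ) / π ≤ q := div_le_self (by positivity) (by linarith [Real.pi_gt_three])
    calc ((q : ℝ) / π) ^ ((s.re + charParity χ) / 2) ≤ (q : ℝ) ^ ((s.re + charParity χ) / 2) :=
          Real.rpow_le_rpow (by positivity) hqπ ha0
      _ ≤ (q : ℝ) ^ x := Real.rpow_le_rpow_of_exponent_le hq1 ha1
      _ = Real.exp (Real.log q * x) := Real.rpow_def_of_pos (by positivity) x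
      _ ≤ Real.exp (q * x ^ (3 / 2 : ℝ)) := by
          apply Real.exp_le_exp.2
          have hlq : Real.log q ≤ q := Real.log_le_self (by positivity)
          nlinarith
  rw [norm_dirichletXi_eq h1 hs0]
  calc ‖χ.LFunction s‖ * ‖Complex.Gamma w‖ * ((q : ℝ) / π) ^ ((s.re + charParity χ) / 2)
      ≤ Real.exp (q * Z * x ^ (3 / 2 : ℝ)) * Real.exp (13 * x ^ (3 / 2 : ℝ)) *
          Real.exp (q * x ^ (3 / 2 : ℝ)) := by gcongr
    _ = Real.exp ((q * Z + 13 + q) * x ^ (3 / 2 : ℝ)) := by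
        rw [← Real.exp_add, ← Real.exp_add]; ring_nf

/-- `|ξ(1 − s̄, χ)| = |ξ(s, χ)|` (primitive `χ ≠ 1`): the reflection in the critical line preserves
the modulus (`|ε(χ)| = 1`). [cite: MontgomeryVaughan2007, Cor 10.8] -/
theorem norm_dirichletXi_one_sub_conj (hχ : χ.IsPrimitive) (h1 : χ ≠ 1) (s : ℂ) :
    ‖dirichletXi χ (1 - conj s)‖ = ‖dirichletXi χ s‖ := by
  rw [dirichletXi_one_sub_conj hχ h1, norm_mul, norm_rootNumber' hχ, one_mul, Complex.norm_conj]

/-- **Upper bound on the whole right half-plane**: `|ξ(s, χ)| ≤ exp(K‖s‖^{3/2})` for `Re s > 0`,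
`‖s‖ ≥ 3` — on `Re s < ½` reflect (`|ξ(s)| = |ξ(1 − s̄)|`, `Re(1 − s̄) > ½`). [folklore] -/
private theorem exists_norm_dirichletXi_le_exp' (hχ : χ.IsPrimitive) (h1 : χ ≠ 1) :
    ∃ K : ℝ, 0 ≤ K ∧ ∀ s : ℂ, 0 < s.re → 3 ≤ ‖s‖ →
      ‖dirichletXi χ s‖ ≤ Real.exp (K * ‖s‖ ^ (3 / 2 : ℝ)) := by
  obtain ⟨K, hK0, hK⟩ := exists_norm_dirichletXi_le_exp h1
  refine ⟨(2 : ℝ) ^ (3 / 2 : ℝ) * K, by positivity, fun s hs h3 ↦ ?_⟩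
  have h2K : K ≤ (2 : ℝ) ^ (3 / 2 : ℝ) * K := by
    have : (1 : ℝ) ≤ (2 : ℝ) ^ (3 / 2 : ℝ) := Real.one_le_rpow (by norm_num) (by norm_num)
    nlinarith
  have hx32 : 0 ≤ ‖s‖ ^ (3 / 2 : ℝ) := by positivity
  rcases le_or_gt (1 / 2 : ℝ) s.re with hle | hlt
  · refine (hK s hle (by linarith)).trans (Real.exp_le_exp.2 ?_)
    exact mul_le_mul_of_nonneg_right h2K hx32
  · set s' : ℂ := 1 - conj s with hs'
    have hre' : 1 / 2 ≤ s'.re := by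
      rw [hs']; simp only [Complex.sub_re, Complex.one_re, Complex.conj_re]; linarith
    have hn' : 2 ≤ ‖s'‖ := by
      have := norm_sub_norm_le (conj s) 1
      rw [Complex.norm_conj, norm_one, norm_sub_rev] at this
      rw [hs']; linarith
    have hn'' : ‖s'‖ ≤ 2 * ‖s‖ := by
      have := norm_sub_le (1 : ℂ) (conj s)
      rw [Complex.norm_conj, norm_one] at this
      rw [hs']; linarith
    rw [← norm_dirichletXi_one_sub_conj hχ h1 s]
    refine (hK s' hre' hn').trans (Real.exp_le_exp.2 ?_)
    calc K * ‖s'‖ ^ (3 / 2 : ℝ) ≤ K * (2 * ‖s‖) ^ (3 / 2 : ℝ) := by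
          gcongr
      _ = (2 : ℝ) ^ (3 / 2 : ℝ) * K * ‖s‖ ^ (3 / 2 : ℝ) := by
          rw [Real.mul_rpow (by norm_num) (norm_nonneg _)]; ring

/-- **`1/L(s, χ)` on `σ ≥ 1`, `|t| ≥ 1`**: `L(s, χ) ≠ 0` and `‖L(s, χ)⁻¹‖ ≤ D (log q + log(|t| + 4))`
with one absolute `D` (Montgomery–Vaughan Theorem 11.4, (11.7)/(11.10); near an exceptional zero `β`
the extra factor `1 + 1/|s − β|` is `≤ 2` because `|s − β| ≥ |t| ≥ 1`).
[cite: MontgomeryVaughan2007, Theorem 11.4] -/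
theorem exists_norm_inv_LFunction_le :
    ∃ D : ℝ, 0 < D ∧ ∀ (q : ℕ) [NeZero q] (χ : DirichletCharacter ℂ q), χ ≠ 1 →
      ∀ s : ℂ, 1 ≤ s.re → 1 ≤ |s.im| →
        χ.LFunction s ≠ 0 ∧ ‖(χ.LFunction s)⁻¹‖ ≤ D * (Real.log q + Real.log (|s.im| + 4)) := by
  obtain ⟨c, hc, -, C, hC0, -, -, hA, hB⟩ := exists_inv_LFunction_bounds
  refine ⟨2 * (C + 1), by positivity, fun q _ χ hχ s hs ht ↦ ?_⟩
  set ℒ : ℝ := Real.log q + Real.log (|s.im| + 4) with hℒ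
  have hℒ0 : 0 < ℒ := ell_pos q s.im
  have hsre : 1 - c / ℒ ≤ s.re := by
    have : 0 ≤ c / ℒ := div_nonneg hc.le hℒ0.le
    linarith
  by_cases hex : ∃ β : ℝ, χ.LFunction β = 0 ∧ 1 - 2 * c / (Real.log q + Real.log 4) < β
  · obtain ⟨β, hβ0, hβc⟩ := hex
    obtain ⟨-, -, hBs⟩ := hB q χ hχ β hβ0 hβc
    have hsβ : s ≠ (β : ℂ) := by
      intro h
      have := congrArg Complex.im h
      rw [Complex.ofReal_im] at this
      rw [this, abs_zero] at ht
      linarith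
    obtain ⟨hne, hle⟩ := hBs s hsre hsβ
    refine ⟨hne, hle.trans ?_⟩
    have hdist : ‖s - (β : ℂ)‖⁻¹ ≤ 1 := by
      have h1 : 1 ≤ ‖s - (β : ℂ)‖ := by
        have := Complex.abs_im_le_norm (s - β)
        rw [Complex.sub_im, Complex.ofReal_im, sub_zero] at this
        linarith
      exact inv_le_one_of_one_le₀ h1
    calc C * ℒ * (1 + ‖s - (β : ℂ)‖⁻¹) ≤ C * ℒ * 2 := by
          apply mul_le_mul_of_nonneg_left (by linarith) (by positivity)
      _ ≤ 2 * (C + 1) * ℒ := by nlinarith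
  · simp only [not_exists, not_and, not_lt] at hex
    obtain ⟨hne, hle⟩ := hA q χ hχ (fun β hβ ↦ hex β hβ) s hsre
    refine ⟨hne, hle.trans ?_⟩
    nlinarith

/-- **Lower bound** `exp(−K‖s‖^{3/2}) ≤ |ξ(s, χ)|` for `Re s ≥ 1`, `‖s‖ ≥ 3` (`K` depending on `q`
only): `1/|L| ≪ log(q(|t|+4))` for `|t| ≥ 1` (MV Theorem 11.4) and `|L| ≥ (σ−1)/σ ≥ ½` for
`|t| < 1` (then `σ ≥ 2`); Stirling for `Γ`; `(q/π)^{Re} ≥ (1/4)^{Re} ≥ e^{−3‖s‖}`. [folklore] -/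
private theorem exists_exp_neg_le_norm_dirichletXi (h1 : χ ≠ 1) :
    ∃ K : ℝ, 0 ≤ K ∧ ∀ s : ℂ, 1 ≤ s.re → 3 ≤ ‖s‖ →
      Real.exp (-(K * ‖s‖ ^ (3 / 2 : ℝ))) ≤ ‖dirichletXi χ s‖ := by
  obtain ⟨D, hD, hDb⟩ := exists_norm_inv_LFunction_le
  refine ⟨D * (q + 5) + 1 + 13 + 3, by positivity, fun s hs h3 ↦ ?_⟩
  have hs0 : 0 < s.re := by linarith
  set x : ℝ := ‖s‖ with hx
  have hx1 : 1 ≤ x := by linarith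
  have hx0 : 0 < x := by linarith
  have h32 : x ≤ x ^ (3 / 2 : ℝ) := by
    have := Real.rpow_le_rpow_of_exponent_le hx1 (show (1 : ℝ) ≤ 3 / 2 by norm_num)
    rwa [Real.rpow_one] at this
  have h032 : 1 ≤ x ^ (3 / 2 : ℝ) := Real.one_le_rpow hx1 (by norm_num)
  obtain ⟨hwlo, hwhi⟩ := norm_half_add_parity_bounds (χ := χ) hs0.le hx1
  set w : ℂ := (s + charParity χ) / 2 with hw
  have hwre : 0 < w.re := by
    rw [hw]
    simp only [Complex.div_ofNat_re, Complex.add_re, Complex.natCast_re]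
    linarith [(charParity χ).cast_nonneg (α := ℝ)]
  have hw1 : 1 ≤ ‖w‖ := by linarith
  have hq1 : (1 : ℝ) ≤ q := by exact_mod_cast Nat.one_le_iff_ne_zero.2 (NeZero.ne q)
  -- factor 1: `L(s, χ)`
  have hL : Real.exp (-((D * (q + 5) + 1) * x ^ (3 / 2 : ℝ))) ≤ ‖χ.LFunction s‖ := by
    rcases le_or_gt 1 |s.im| with ht | ht
    · obtain ⟨hne, hinv⟩ := hDb q χ h1 s hs ht
      have hLpos : 0 < ‖χ.LFunction s‖ := norm_pos_iff.2 hne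
      have hℒ : Real.log q + Real.log (|s.im| + 4) ≤ q + 4 + x := by
        have h1' : Real.log q ≤ q := Real.log_le_self (Nat.cast_nonneg q)
        have h2' : Real.log (|s.im| + 4) ≤ |s.im| + 4 := Real.log_le_self (by positivity)
        have h3' : |s.im| ≤ x := Complex.abs_im_le_norm s
        linarith
      have hy : ‖χ.LFunction s‖⁻¹ ≤ D * (q + 5) * x := by
        rw [← norm_inv]
        refine hinv.trans ?_
        have hqx : (q : ℝ) + 4 + x ≤ (q + 5) * x := by
          nlinarith [mul_nonneg (by positivity : (0 : ℝ) ≤ q + 4) (by linarith : (0 : ℝ) ≤ x - 1)]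
        calc D * (Real.log q + Real.log (|s.im| + 4)) ≤ D * (q + 4 + x) := by gcongr
          _ ≤ D * ((q + 5) * x) := by gcongr
          _ = D * (q + 5) * x := by ring
      have hT0 : 0 < D * (q + 5) * x := by positivity
      calc Real.exp (-((D * (q + 5) + 1) * x ^ (3 / 2 : ℝ))) ≤ Real.exp (-(D * (q + 5) * x)) := by
            apply Real.exp_le_exp.2
            nlinarith
        _ ≤ (D * (q + 5) * x)⁻¹ := by
            rw [Real.exp_neg]
            exact inv_anti₀ hT0 (by linarith [Real.add_one_le_exp (D * (q + 5) * x)])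
        _ ≤ ‖χ.LFunction s‖ := inv_le_of_inv_le₀ hLpos hy
    · have hre2 : 2 ≤ s.re := by
        have := Complex.norm_le_abs_re_add_abs_im s
        rw [abs_of_pos hs0] at this
        linarith
      have hlow := norm_LFunction_ge χ (by linarith : 1 < s.re)
      have hhalf : (1 : ℝ) / 2 ≤ (s.re - 1) / s.re := by
        rw [div_le_div_iff₀ (by norm_num) (by linarith)]
        linarith
      calc Real.exp (-((D * (q + 5) + 1) * x ^ (3 / 2 : ℝ))) ≤ Real.exp (-1) := by
            apply Real.exp_le_exp.2
            have : (1 : ℝ) ≤ (D * (q + 5) + 1) * x ^ (3 / 2 : ℝ) := by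
              nlinarith [mul_nonneg (by positivity : (0 : ℝ) ≤ D * (q + 5))
                (by positivity : (0 : ℝ) ≤ x ^ (3 / 2 : ℝ))]
            linarith
        _ ≤ 1 / 2 := by
            rw [Real.exp_neg]
            have h2 : (2 : ℝ) ≤ Real.exp 1 := by linarith [Real.add_one_le_exp (1 : ℝ)]
            rw [one_div]
            exact inv_anti₀ (by norm_num) h2
        _ ≤ ‖χ.LFunction s‖ := hhalf.trans hlow
  -- factor 2: `Γ((s+κ)/2)`
  have hG : Real.exp (-(13 * x ^ (3 / 2 : ℝ))) ≤ ‖Complex.Gamma w‖ := by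
    refine (Real.exp_le_exp.2 ?_).trans (exp_neg_le_norm_Gamma hwre hw1)
    have : ‖w‖ ^ (3 / 2 : ℝ) ≤ x ^ (3 / 2 : ℝ) := Real.rpow_le_rpow (norm_nonneg _) hwhi (by norm_num)
    linarith
  -- factor 3: `(q/π)^{(σ+κ)/2}`
  have hP : Real.exp (-(3 * x ^ (3 / 2 : ℝ))) ≤ ((q : ℝ) / π) ^ ((s.re + charParity χ) / 2) := by
    have ha0 : 0 ≤ (s.re + charParity χ) / 2 := by
      linarith [(charParity χ).cast_nonneg (α := ℝ)]
    have ha1 : (s.re + charParity χ) / 2 ≤ x := by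
      have hre : s.re ≤ ‖s‖ := Complex.re_le_norm s
      have hκ : (charParity χ : ℝ) ≤ 1 := by exact_mod_cast charParity_le_one χ
      rw [hx]; linarith
    have hq4 : (1 : ℝ) / 4 ≤ q / π := by
      rw [div_le_div_iff₀ (by norm_num) Real.pi_pos]
      nlinarith [Real.pi_le_four]
    have hl4 : -3 ≤ Real.log (1 / 4) := by
      rw [one_div, Real.log_inv]
      have := Real.log_le_sub_one_of_pos (by norm_num : (0 : ℝ) < 4)
      linarith
    calc Real.exp (-(3 * x ^ (3 / 2 : ℝ))) ≤ Real.exp (Real.log (1 / 4) * ((s.re + charParity χ) / 2)) := by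
          apply Real.exp_le_exp.2
          nlinarith
      _ = (1 / 4 : ℝ) ^ ((s.re + charParity χ) / 2) := (Real.rpow_def_of_pos (by norm_num) _).symm
      _ ≤ ((q : ℝ) / π) ^ ((s.re + charParity χ) / 2) := Real.rpow_le_rpow (by norm_num) hq4 ha0
  rw [norm_dirichletXi_eq h1 hs0]
  calc Real.exp (-((D * (q + 5) + 1 + 13 + 3) * x ^ (3 / 2 : ℝ)))
      = Real.exp (-((D * (q + 5) + 1) * x ^ (3 / 2 : ℝ))) * Real.exp (-(13 * x ^ (3 / 2 : ℝ))) *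
          Real.exp (-(3 * x ^ (3 / 2 : ℝ))) := by
        rw [← Real.exp_add, ← Real.exp_add]; ring_nf
    _ ≤ ‖χ.LFunction s‖ * ‖Complex.Gamma w‖ * ((q : ℝ) / π) ^ ((s.re + charParity χ) / 2) := by
        gcongr

/-! ## The quotient `ξ(x, χ)/ξ(x+1, χ)` on the positive real axis -/

/-- **`ξ(x, χ)/ξ(x + 1, χ) → 0` as `x → +∞`** along the reals: `|L(x)| ≤ 2`, `|L(x+1)| ≥ ½`,
`Γ(u)/Γ(u + ½) ≤ e (u + ½)^{−1/2}` (`u = (x+κ)/2`) and `(q/π)^{−1/2}`, so the quotient is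
`O(x^{−1/2})`. [folklore] -/
private theorem tendsto_dirichletXi_div_atTop (h1 : χ ≠ 1) :
    Tendsto (fun x : ℝ ↦ dirichletXi χ x / dirichletXi χ (x + 1)) atTop (𝓝 0) := by
  set P : ℝ := (q : ℝ) / π with hP
  have hP0 : 0 < P := div_pos (Nat.cast_pos.2 (NeZero.pos q)) Real.pi_pos
  set A : ℝ := 4 * Real.exp 1 * P ^ (-(1 / 2 : ℝ)) with hA
  have hb : ∀ x : ℝ, 2 ≤ x →
      ‖dirichletXi χ x / dirichletXi χ (x + 1)‖ ≤ A * (x / 2) ^ (-(1 / 2 : ℝ)) := by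
    intro x hx
    have hκ1 : (charParity χ : ℝ) ≤ 1 := by exact_mod_cast charParity_le_one χ
    have hκ0 : (0 : ℝ) ≤ charParity χ := (charParity χ).cast_nonneg
    set u : ℝ := (x + charParity χ) / 2 with hu
    have hu1 : 1 ≤ u := by rw [hu]; linarith
    have hu0 : 0 < u := by linarith
    have hv0 : 0 < u + 1 / 2 := by linarith
    -- the two moduli through (10.19)
    have hN : ‖dirichletXi χ x‖ = ‖χ.LFunction x‖ * Real.Gamma u * P ^ u := by
      rw [norm_dirichletXi_eq h1 (by simp only [Complex.ofReal_re]; linarith)]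
      have : ((x : ℂ) + (charParity χ : ℂ)) / 2 = ((u : ℝ) : ℂ) := by rw [hu]; push_cast; ring
      rw [this, Complex.Gamma_ofReal, Complex.norm_real, Real.norm_of_nonneg
        (Real.Gamma_pos_of_pos hu0).le, Complex.ofReal_re]
    have hD : ‖dirichletXi χ (x + 1)‖ =
        ‖χ.LFunction (x + 1)‖ * Real.Gamma (u + 1 / 2) * P ^ (u + 1 / 2) := by
      have hre : (0 : ℝ) < ((x : ℂ) + 1).re := by
        simp only [Complex.add_re, Complex.ofReal_re, Complex.one_re]; linarith
      rw [norm_dirichletXi_eq h1 hre]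
      have : ((x : ℂ) + 1 + (charParity χ : ℂ)) / 2 = ((u + 1 / 2 : ℝ) : ℂ) := by
        rw [hu]; push_cast; ring
      have hexp : (((x : ℂ) + 1).re + (charParity χ : ℝ)) / 2 = u + 1 / 2 := by
        simp only [Complex.add_re, Complex.ofReal_re, Complex.one_re]; rw [hu]; ring
      rw [this, Complex.Gamma_ofReal, Complex.norm_real, Real.norm_of_nonneg
        (Real.Gamma_pos_of_pos hv0).le, hexp]
    -- factor bounds
    have hLx : ‖χ.LFunction x‖ ≤ 2 := by
      have hs : 1 < (x : ℂ).re := by simp only [Complex.ofReal_re]; linarith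
      rw [DirichletCharacter.LFunction_eq_LSeries χ hs]
      refine (norm_LSeries_le_of_norm_le_one (fun n ↦ DirichletCharacter.norm_le_one χ _) hs).trans
        ?_
      simp only [Complex.ofReal_re]
      rw [div_le_iff₀ (by linarith)]
      linarith
    have hLx1 : 1 / 2 ≤ ‖χ.LFunction (x + 1)‖ := by
      have hs : 1 < ((x : ℂ) + 1).re := by
        simp only [Complex.add_re, Complex.ofReal_re, Complex.one_re]; linarith
      refine le_trans ?_ (norm_LFunction_ge χ hs)
      simp only [Complex.add_re, Complex.ofReal_re, Complex.one_re, add_sub_cancel_right]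
      rw [div_le_div_iff₀ (by norm_num) (by linarith)]
      linarith
    have hΓ := real_Gamma_le_mul_Gamma_add_half hu1
    have hΓpos : 0 < Real.Gamma (u + 1 / 2) := Real.Gamma_pos_of_pos hv0
    have hPu : 0 < P ^ u := Real.rpow_pos_of_pos hP0 u
    have hPu' : 0 < P ^ (u + 1 / 2) := Real.rpow_pos_of_pos hP0 _
    have hNle : ‖dirichletXi χ x‖ ≤
        2 * (Real.exp 1 * (u + 1 / 2) ^ (-(1 / 2 : ℝ)) * Real.Gamma (u + 1 / 2)) * P ^ u := by
      rw [hN]; gcongr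
    have hDle : 1 / 2 * Real.Gamma (u + 1 / 2) * P ^ (u + 1 / 2) ≤ ‖dirichletXi χ (x + 1)‖ := by
      rw [hD]; gcongr
    have hDb0 : 0 < 1 / 2 * Real.Gamma (u + 1 / 2) * P ^ (u + 1 / 2) := by positivity
    have hPP : P ^ (-(1 / 2 : ℝ)) * P ^ (u + 1 / 2) = P ^ u := by
      rw [← Real.rpow_add hP0]; congr 1; ring
    have hkey : 2 * (Real.exp 1 * (u + 1 / 2) ^ (-(1 / 2 : ℝ)) * Real.Gamma (u + 1 / 2)) * P ^ u =
        (A * (u + 1 / 2) ^ (-(1 / 2 : ℝ))) * (1 / 2 * Real.Gamma (u + 1 / 2) * P ^ (u + 1 / 2)) := by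
      rw [hA, ← hPP]; ring
    calc ‖dirichletXi χ x / dirichletXi χ (x + 1)‖
        = ‖dirichletXi χ x‖ / ‖dirichletXi χ (x + 1)‖ := norm_div _ _
      _ ≤ (2 * (Real.exp 1 * (u + 1 / 2) ^ (-(1 / 2 : ℝ)) * Real.Gamma (u + 1 / 2)) * P ^ u) /
            (1 / 2 * Real.Gamma (u + 1 / 2) * P ^ (u + 1 / 2)) :=
          div_le_div₀ (by positivity) hNle hDb0 hDle
      _ = A * (u + 1 / 2) ^ (-(1 / 2 : ℝ)) := by
          rw [hkey, mul_div_assoc, div_self hDb0.ne', mul_one]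
      _ ≤ A * (x / 2) ^ (-(1 / 2 : ℝ)) := by
          have hA0 : 0 ≤ A := by positivity
          refine mul_le_mul_of_nonneg_left ?_ hA0
          exact Real.rpow_le_rpow_of_nonpos (by positivity) (by rw [hu]; linarith) (by norm_num)
  have ht1 : Tendsto (fun x : ℝ ↦ x / 2) atTop atTop := tendsto_id.atTop_div_const (by norm_num)
  have ht2 : Tendsto (fun x : ℝ ↦ (x / 2) ^ (-(1 / 2 : ℝ))) atTop (𝓝 0) :=
    (tendsto_rpow_neg_atTop (by norm_num : (0 : ℝ) < 1 / 2)).comp ht1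
  have ht3 : Tendsto (fun x : ℝ ↦ A * (x / 2) ^ (-(1 / 2 : ℝ))) atTop (𝓝 0) := by
    simpa using ht2.const_mul A
  refine squeeze_zero_norm' ?_ ht3
  filter_upwards [eventually_ge_atTop (2 : ℝ)] with x hx using hb x hx

/-! ## The shift inequality `|ξ(z, χ)| < |ξ(z + 1, χ)|` on `Re z > 0` -/

/-- **`|ξ(z, χ)| < |ξ(z + 1, χ)|` for `Re z > 0`** (`χ` primitive mod `q ≠ 1`) — the Dirichlet
analogue of Lagarias' `|ξ(s − 1)| < |ξ(s)|`, `Re s > 1` (tree `lagarias2005_lemma_2_1`, `h = ½`).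
Proof (Phragmén–Lindelöf instead of the Hadamard product): `g = ξ(·, χ)/ξ(· + 1, χ)` is holomorphic
on `Re z ≥ 0` (`ξ(s, χ) ≠ 0` for `Re s ≥ 1`), `|g| = 1` on `Re z = 0` (`ξ(1 − s̄, χ) = ε(χ) conj ξ(s, χ)`),
`g(x) → 0` along the reals, and `|g(z)| ≤ exp(B|z|^{3/2})` on the half-plane (Stirling; MV Lemma
10.15; MV Theorem 11.4), so `|g| ≤ 1` by Phragmén–Lindelöf, and `< 1` by the maximum modulus
principle (`g` is not a unimodular constant since `g(x) → 0`). In de Branges' variable `s = 1 − iz`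
this is exactly the printed `|E_χ(1, x − iy)| < |E_χ(1, x + iy)|`, `y > 0` (p. 12 l. 27–28), stated
here for either parity. [cite: deBranges1986, p. 12 l. 22–29] -/
theorem norm_dirichletXi_lt_norm_dirichletXi_add_one (hχ : χ.IsPrimitive) (hq : q ≠ 1) {z : ℂ}
    (hz : 0 < z.re) : ‖dirichletXi χ z‖ < ‖dirichletXi χ (z + 1)‖ := by
  have h1 : χ ≠ 1 := ne_one_of_isPrimitive' hχ hq
  have hne : ∀ w : ℂ, 0 ≤ w.re → dirichletXi χ (w + 1) ≠ 0 := fun w hw ↦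
    dirichletXi_ne_zero_of_not_mem_strip hχ h1
      (Or.inr (by simp only [Complex.add_re, Complex.one_re]; linarith))
  set g : ℂ → ℂ := fun w ↦ dirichletXi χ w / dirichletXi χ (w + 1) with hg
  have hdiff : Differentiable ℂ (dirichletXi χ) := differentiable_dirichletXi h1
  have hdiff1 : Differentiable ℂ (fun w : ℂ ↦ dirichletXi χ (w + 1)) :=
    hdiff.comp (differentiable_id.add_const 1)
  -- (1) holomorphic on the open half-plane, continuous on the closed one
  have hd : DiffContOnCl ℂ g {w : ℂ | 0 < w.re} := by
    refine ⟨hdiff.differentiableOn.div hdiff1.differentiableOn fun w hw ↦ hne w (le_of_lt hw), ?_⟩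
    rw [closure_setOf_lt_re]
    exact hdiff.continuous.continuousOn.div hdiff1.continuous.continuousOn fun w hw ↦ hne w hw
  -- (2) growth `exp(B |w|^{3/2})`
  obtain ⟨K₁, hK₁0, hK₁⟩ := exists_norm_dirichletXi_le_exp' hχ h1
  obtain ⟨K₂, hK₂0, hK₂⟩ := exists_exp_neg_le_norm_dirichletXi (χ := χ) h1
  have hexp : ∃ c < (2 : ℝ), ∃ B, g =O[Bornology.cobounded ℂ ⊓ 𝓟 {w : ℂ | 0 < w.re}]
      fun w ↦ Real.exp (B * ‖w‖ ^ c) := by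
    refine ⟨3 / 2, by norm_num, K₁ + (2 : ℝ) ^ (3 / 2 : ℝ) * K₂, ?_⟩
    refine Asymptotics.IsBigO.of_bound 1 ?_
    rw [Filter.eventually_inf_principal]
    refine ((Metric.hasBasis_cobounded_compl_closedBall (0 : ℂ)).eventually_iff).2
      ⟨4, trivial, fun w hw hw' ↦ ?_⟩
    have hw4 : 4 < ‖w‖ := by
      simpa [Metric.mem_closedBall, dist_zero_right] using hw
    have hw' : 0 < w.re := hw'
    rw [one_mul, Real.norm_of_nonneg (Real.exp_pos _).le]
    have hN := hK₁ w hw' (by linarith)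
    have hw1re : 1 ≤ (w + 1).re := by simp only [Complex.add_re, Complex.one_re]; linarith
    have hw1n : 3 ≤ ‖w + 1‖ := by
      have := norm_sub_le_norm_add w 1
      rw [norm_one] at this
      linarith
    have hD := hK₂ (w + 1) hw1re hw1n
    have hw1le : ‖w + 1‖ ≤ 2 * ‖w‖ := (norm_add_le _ _).trans (by rw [norm_one]; linarith)
    calc ‖g w‖ = ‖dirichletXi χ w‖ / ‖dirichletXi χ (w + 1)‖ := norm_div _ _
      _ ≤ Real.exp (K₁ * ‖w‖ ^ (3 / 2 : ℝ)) / Real.exp (-(K₂ * ‖w + 1‖ ^ (3 / 2 : ℝ))) :=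
          div_le_div₀ (Real.exp_pos _).le hN (Real.exp_pos _) hD
      _ = Real.exp (K₁ * ‖w‖ ^ (3 / 2 : ℝ) + K₂ * ‖w + 1‖ ^ (3 / 2 : ℝ)) := by
          rw [Real.exp_neg, div_inv_eq_mul, Real.exp_add]
      _ ≤ Real.exp ((K₁ + (2 : ℝ) ^ (3 / 2 : ℝ) * K₂) * ‖w‖ ^ (3 / 2 : ℝ)) := by
          apply Real.exp_le_exp.2
          have h := Real.rpow_le_rpow (norm_nonneg _) hw1le (show (0 : ℝ) ≤ 3 / 2 by norm_num)
          rw [Real.mul_rpow (by norm_num) (norm_nonneg _)] at h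
          nlinarith [mul_le_mul_of_nonneg_left h hK₂0]
  -- (3) decay along the positive real axis
  have hre : Tendsto (fun x : ℝ ↦ g x) atTop (𝓝 0) := tendsto_dirichletXi_div_atTop h1
  -- (4) modulus one on the imaginary axis
  have him : ∀ y : ℝ, ‖g (y * I)‖ ≤ 1 := by
    intro y
    have heq : ‖dirichletXi χ (y * I + 1)‖ = ‖dirichletXi χ (y * I)‖ := by
      have h := norm_dirichletXi_one_sub_conj hχ h1 (y * I)
      have : (1 : ℂ) - conj ((y : ℂ) * I) = y * I + 1 := by
        rw [map_mul, Complex.conj_ofReal, Complex.conj_I]; ring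
      rwa [this] at h
    show ‖dirichletXi χ (y * I) / dirichletXi χ (y * I + 1)‖ ≤ 1
    rw [norm_div, heq]
    exact div_self_le_one _
  -- Phragmén–Lindelöf: `|g| ≤ 1` on the closed half-plane
  have hle : ∀ w : ℂ, 0 ≤ w.re → ‖g w‖ ≤ 1 := fun w hw ↦
    PhragmenLindelof.right_half_plane_of_tendsto_zero_on_real hd hexp hre him hw
  -- strictness via the maximum modulus principle
  have hz1 : 0 < ‖dirichletXi χ (z + 1)‖ := norm_pos_iff.2 (hne z hz.le)
  by_contra hcon
  have hge : ‖dirichletXi χ (z + 1)‖ ≤ ‖dirichletXi χ z‖ := not_lt.1 hcon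
  have hgz : ‖g z‖ = 1 := by
    refine le_antisymm (hle z hz.le) ?_
    show 1 ≤ ‖dirichletXi χ z / dirichletXi χ (z + 1)‖
    rw [norm_div, le_div_iff₀ hz1, one_mul]
    exact hge
  have hU : IsOpen {w : ℂ | 0 < w.re} := isOpen_lt continuous_const Complex.continuous_re
  have hUc : IsPreconnected {w : ℂ | 0 < w.re} := (convex_halfSpace_re_gt 0).isPreconnected
  have hmax : IsMaxOn (norm ∘ g) {w : ℂ | 0 < w.re} z := fun w hw ↦ by
    simp only [Set.mem_setOf_eq, Function.comp_apply, hgz]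
    exact hle w (le_of_lt hw)
  have heq := Complex.eqOn_of_isPreconnected_of_isMaxOn_norm hUc hU hd.differentiableOn hz hmax
  have hev : ∀ᶠ x : ℝ in atTop, ‖g x‖ < 1 / 2 := by
    have h := hre.norm
    rw [norm_zero] at h
    exact h.eventually (gt_mem_nhds (by norm_num))
  obtain ⟨x, hx1, hx2⟩ := (hev.and (eventually_gt_atTop 0)).exists
  have hxU : (x : ℂ) ∈ {w : ℂ | 0 < w.re} := by
    simpa only [Set.mem_setOf_eq, Complex.ofReal_re] using hx2
  have hgx : g x = g z := heq hxU
  rw [hgx, hgz] at hx1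
  linarith

/-! ## de Branges' structure functions `E_χ(a, z)` are Hermite–Biehler -/

/-- **`E_χ(a, ·)` is a Hermite–Biehler function** for every primitive `χ` mod `r ≠ 1` (either
parity) and every `a ≥ 1`: `E_χ(a, z) = a^{−iz/2} ξ(1 − iz, χ)` is entire and
`|E_χ(a, z̄)| < |E_χ(a, z)|` on `Im z > 0`. With `w = −iz` (`Re w = Im z > 0`):
`1 − iz = w + 1`, `1 − i z̄ = 1 − w̄`, so `|ξ(1 − i z̄, χ)| = |ξ(w, χ)| < |ξ(w + 1, χ)| = |ξ(1 − iz, χ)|`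
(`norm_dirichletXi_one_sub_conj`, `norm_dirichletXi_lt_norm_dirichletXi_add_one`), while
`|a^{−i z̄/2}| = a^{−y/2} ≤ a^{y/2} = |a^{−iz/2}|`. RH-FREE. [cite: deBranges1986, p. 12 l. 22–29] -/
theorem isHermiteBiehler_EChar {r : ℕ} [NeZero r] {χ : DirichletCharacter ℂ r} (hr : r ≠ 1)
    (hχ : χ.IsPrimitive) {a : ℝ} (ha : 1 ≤ a) : IsHermiteBiehler (EChar χ a) := by
  have h1 : χ ≠ 1 := ne_one_of_isPrimitive' hχ hr
  have ha0 : (0 : ℝ) < a := by linarith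
  refine ⟨?_, fun z hz ↦ ?_⟩
  · -- `E_χ(a, ·)` is entire
    have hd1 : Differentiable ℂ (fun z : ℂ ↦ (a : ℂ) ^ (-(I * z) / 2)) :=
      Differentiable.const_cpow (by fun_prop) (Or.inl (by exact_mod_cast ha0.ne'))
    have hd2 : Differentiable ℂ (fun z : ℂ ↦ dirichletXi χ (1 - I * z)) :=
      (differentiable_dirichletXi h1).comp (by fun_prop)
    exact hd1.mul hd2
  · -- the inequality
    set w : ℂ := -(I * z) with hw
    have hwre : 0 < w.re := by
      rw [hw]; simp only [Complex.neg_re, Complex.mul_re, Complex.I_re, Complex.I_im, zero_mul,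
        one_mul, zero_sub, neg_neg]; exact hz
    have hcore := norm_dirichletXi_lt_norm_dirichletXi_add_one hχ hr hwre
    have hz1 : (1 : ℂ) - I * z = w + 1 := by rw [hw]; ring
    have hz2 : (1 : ℂ) - I * conj z = 1 - conj w := by
      rw [hw, map_neg, map_mul, Complex.conj_I]; ring
    have hrefl : ‖dirichletXi χ (1 - I * conj z)‖ = ‖dirichletXi χ w‖ := by
      rw [hz2, norm_dirichletXi_one_sub_conj hχ h1]
    -- the exponential prefactors
    have hp1 : ‖(a : ℂ) ^ (-(I * conj z) / 2)‖ = a ^ (-(z.im / 2)) := by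
      rw [Complex.norm_cpow_eq_rpow_re_of_pos ha0]
      congr 1
      simp only [Complex.div_ofNat_re, Complex.neg_re, Complex.mul_re, Complex.I_re, Complex.I_im,
        Complex.conj_re, Complex.conj_im, zero_mul, one_mul, zero_sub, neg_neg]
      ring
    have hp2 : ‖(a : ℂ) ^ (-(I * z) / 2)‖ = a ^ (z.im / 2) := by
      rw [Complex.norm_cpow_eq_rpow_re_of_pos ha0]
      congr 1
      simp only [Complex.div_ofNat_re, Complex.neg_re, Complex.mul_re, Complex.I_re, Complex.I_im,
        zero_mul, one_mul, zero_sub, neg_neg]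
    have hpow : (a : ℝ) ^ (-(z.im / 2)) ≤ a ^ (z.im / 2) :=
      Real.rpow_le_rpow_of_exponent_le ha (by linarith)
    have hpos : 0 < (a : ℝ) ^ (z.im / 2) := Real.rpow_pos_of_pos ha0 _
    simp only [EChar]
    rw [norm_mul, norm_mul, hp1, hp2, hrefl, hz1]
    calc a ^ (-(z.im / 2)) * ‖dirichletXi χ w‖ ≤ a ^ (z.im / 2) * ‖dirichletXi χ w‖ :=
        mul_le_mul_of_nonneg_right hpow (norm_nonneg _)
      _ < a ^ (z.im / 2) * ‖dirichletXi χ (w + 1)‖ := mul_lt_mul_of_pos_left hcore hpos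

/-- **de Branges 1986, p. 12 l. 22–29 — discharge of `deBranges1986_isHermiteBiehler_EChar`**: for a
primitive even `χ` mod `r ≠ 1` and `a ≥ 1`, `E_χ(a, ·)` is Hermite–Biehler ("Since
`|E_χ(a, x − iy)| < |E_χ(a, x + iy)|` when `y > 0`, a space `𝓗(E_χ(a))` exists"). de Branges takes the
non-strict inequality from the bound `|W_χ| ≤ 1` of his Theorem 4 and strictness from `W_χ` not being
a unimodular constant; here both come from `isHermiteBiehler_EChar` (Phragmén–Lindelöf and the maximum
modulus principle; no Hadamard product). RH-FREE (unconditional structure-function property, the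
Dirichlet analogue of `lagarias2005_lemma_2_1` at `h = ½`; Conrey–Li GUARD R7, unconditional branch).
[cite: deBranges1986, p. 12 l. 22–29] -/
theorem deBranges1986_isHermiteBiehler_EChar_holds : deBranges1986_isHermiteBiehler_EChar :=
  fun _ _ _ hr hχ _ _ ha ↦ isHermiteBiehler_EChar hr hχ ha

/-- **de Branges 1986, Theorem 4, the bound `|W_χ| ≤ 1` in binder-free form — strictly**: for a
primitive `χ` mod `r ≠ 1` and `Im z > 0`, `‖ε(χ) ξ(1 + iz, χ̄)‖ < ‖ξ(1 − iz, χ)‖` (`W_χ = ε(χ)E♯/E` with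
`E(z) = ξ(1 − iz, χ)`, `E♯(z) = ξ(1 + iz, χ̄)`; this is the first conjunct of `deBranges1986_thm4`,
PROVED, and the printed remark "`|W_χ(z)| < 1`", p. 12 l. 22–25). RH-FREE.
[cite: deBranges1986, Theorem 4, pp. 11–12] -/
theorem norm_rootNumber_mul_dirichletXi_inv_lt {r : ℕ} [NeZero r] {χ : DirichletCharacter ℂ r}
    (hr : r ≠ 1) (hχ : χ.IsPrimitive) {z : ℂ} (hz : 0 < z.im) :
    ‖χ.rootNumber * dirichletXi χ⁻¹ (1 + I * z)‖ < ‖dirichletXi χ (1 - I * z)‖ := by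
  have h1 : χ ≠ 1 := ne_one_of_isPrimitive' hχ hr
  have hE := (isHermiteBiehler_EChar hr hχ le_rfl).norm_conj_lt z hz
  rw [EChar_one, EChar_one] at hE
  have hconj : dirichletXi χ⁻¹ (1 + I * z) = conj (dirichletXi χ (1 - I * conj z)) := by
    rw [conj_dirichletXi h1, map_sub, map_one, map_mul, Complex.conj_I, Complex.conj_conj]
    ring_nf
  rw [norm_mul, norm_rootNumber' hχ, one_mul, hconj, Complex.norm_conj]
  exact hE

/-- **de Branges 1986, Theorem 4 (i)** — the first conjunct of the named fact `deBranges1986_thm4`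
verbatim (`‖ε(χ) ξ(1 + iz, χ⁻¹)‖ ≤ ‖ξ(1 − iz, χ)‖` on `Im z > 0` for primitive even `χ` mod `r ≠ 1`),
PROVED. (The second conjunct — the Mellin formula for `W_χ` — is not discharged here.) RH-FREE.
[cite: deBranges1986, Theorem 4, pp. 11–12] -/
theorem deBranges1986_thm4_i :
    ∀ (r : ℕ) [NeZero r] (χ : DirichletCharacter ℂ r), r ≠ 1 → χ.IsPrimitive → χ.Even →
      ∀ z : ℂ, 0 < z.im →
        ‖χ.rootNumber * dirichletXi χ⁻¹ (1 + I * z)‖ ≤ ‖dirichletXi χ (1 - I * z)‖ :=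
  fun _ _ _ hr hχ _ _ hz ↦ (norm_rootNumber_mul_dirichletXi_inv_lt hr hχ hz).le

end DeBranges1986
end Literature.Analysis.DeBrangesSpaces
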